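import Summits.NavierStokesRegularity.NavierStokesRegularity.Theorems.ScenarioCensusSilenceMeter
import HarnessLib

/-!
# LINE g16-4 «silence-meter» REV 2 port, part 2/4: §F the census rows `Row_A2si0` / `Row_A2siE` / `Row_A2siP` / `Row_A2siU` (proved), `Row_A2siN` (OPEN), nestings, placement of g16-2's
# residual `Row_A2arP` (restated; `Row_A2arP ⇒ EnvelopeLiouville`), the rung decides every row; §G controls

Re-homed for the scenario census (typer seat ns-census-typer-1 g9; the cells A2si0 / A2siE / A2siP / A2siU (LINE g16-4, item 68, census v1.98) and A2siV / A2siW / A2siS (REV 2,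
item 72, census v1.101) are MEMBERS OF RECORD «DECIDED IN KERNEL IN FILES» of block A2 (critic PASS; ref PRE-CHECK ✓ §18.8; lead label); this port makes them TREE-decided):
VERBATIM PORT of ns-idea-2 LINE g16-4 «silence-meter» REV 2, `pub/ideators/ns-idea-2/lines/silence-meter/line-silence-meter.rev2.lean` sha16 72a7ac62b938520d (1078 l. =
rev 1 89ff24c1f2a7581c + §I–§K, lean check rc 0, 0 sorry), split for the 400-line rule into `ScenarioCensusSilenceMeter` (§A–§E) → `…SilenceMeterRows` (§F–§G) →
`…SilenceMeterVolume` (§I laws) → `…SilenceMeterVolumeRows` (§I rows, §J, §K + census KEYS).  Lean text VERBATIM in namespace `…Theorems.ScenarioCensus.SilenceMeter` (the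
line's `…Lines.SilenceMeter` re-homed); port edits: `local notation "E3"` → `abbrev E3` (typer lint), `set_option linter.unusedVariables false` dropped (the record: a port
must drop it; unused binders `_`-prefixed where the linter asks, proof text only), the `variable {C} {u}` line and `open MeasureTheory` repeated per part, the instrument `amp`
(+ `amp_nonneg`, `amp_le`) and the one-limit Liouville law `eq_zero_of_blowdownLimit_zero`, shared VERBATIM with the epoch-meter port, taken BY NAME (`EpochMeter.…`),
`@[conjecture]` on the OPEN rows `Row_A2siN` / `Row_A2siQ` and on the restated residuals `Row_A2arP` / `EnvelopeLiouville` (typed only), one-line docstrings added (gate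
lint).  Statements untouched.

No census VALUE is moved here (the cells become TREE-decided by name; booking is the lead's); NS regularity is NOT proved; (L′) ⟨10661⟩ is untouched; no
summit statement is proved by this file. Lemmas that restate already-landed tree declarations are taken BY NAME (gate lint `dedup.landed`): `amp` = `EpochMeter.amp`, `amp_nonneg` = `EpochMeter.amp_nonneg`, `amp_le` = `EpochMeter.amp_le`, `eq_zero_of_blowdownLimit_zero` = `EpochMeter.eq_zero_of_blowdownLimit_zero`.
-/

-- the summit and its single problem share the name `NavierStokesRegularity` (D-0017 nested layout)
set_option linter.dupNamespace false

noncomputable section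

open Set Function Filter Metric
open scoped Topology
open Literature.Analysis.FluidPDE
open Summit.NavierStokesRegularity.NavierStokesRegularity.Theorems

namespace Summit.NavierStokesRegularity.NavierStokesRegularity.Theorems.ScenarioCensus.SilenceMeter

open MeasureTheory

variable {C : ℝ} {u : ℝ → E3 → E3}

/-! ## F. Census rows (shape `∀ C u, IsTypeIAncientMild C u → <cell> → u ≡ 0` on `t < 0`) -/

/-- **Row A2si-0** (asymptotic silence on a receding similarity ball, EXCLUDED — PROVED): for some ball `B̄(η₀, ρ)`
(`ρ > 0`) and some far-past times `s_k → −∞` the maximal reading over `√(−s_k)·B̄(η₀, ρ)` tends to `0` ⇒ `u ≡ 0`. -/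
def Row_A2si0 : Prop :=
  ∀ (C : ℝ) (u : ℝ → E3 → E3), IsTypeIAncientMild C u →
    (∃ (η₀ : E3) (ρ : ℝ), 0 < ρ ∧ ∃ s δ : ℕ → ℝ, (∀ k, s k < 0) ∧ Tendsto s atTop atBot ∧
        Tendsto δ atTop (𝓝 0) ∧ ∀ k (x : E3), ‖x - Real.sqrt (-s k) • η₀‖ ≤ ρ * Real.sqrt (-s k) →
          Real.sqrt (-s k) * ‖u (s k) x‖ ≤ δ k) →
    ∀ t < 0, ∀ x, u t x = 0

/-- **Row A2si-E** (silent thin cores at receding times, EXCLUDED — PROVED): for some aperture `K > 0` (arbitrarily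
SMALL) and times `s_k → −∞`, `max_{‖x‖ ≤ K√(−s_k)} √(−s_k)‖u(s_k, x)‖ → 0` ⇒ `u ≡ 0`.  The level-`0` corner of
g16-3's open rows `Row_A2epB` (fixed log-length) and `Row_A2epU` (fixed aperture): epochs of log-length `0`
(single slices) and any fixed aperture already suffice once the level tends to `0`. -/
def Row_A2siE : Prop :=
  ∀ (C : ℝ) (u : ℝ → E3 → E3), IsTypeIAncientMild C u →
    (∃ K : ℝ, 0 < K ∧ ∃ s δ : ℕ → ℝ, (∀ k, s k < 0) ∧ Tendsto s atTop atBot ∧ Tendsto δ atTop (𝓝 0) ∧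
        ∀ k (x : E3), ‖x‖ ≤ K * Real.sqrt (-s k) → Real.sqrt (-s k) * ‖u (s k) x‖ ≤ δ k) →
    ∀ t < 0, ∀ x, u t x = 0

/-- **Row A2si-P** (silence outside a paraboloid along a sequence, EXCLUDED — PROVED): for some `K` and times
`s_k → −∞`, `sup_{‖x‖ ≥ K√(−s_k)} √(−s_k)‖u(s_k, x)‖ → 0` ⇒ `u ≡ 0`.  The level-`0` edge of g16-2's open
`Row_A2arP` (there the exterior is only `ε`-quiet for a fixed `ε < 1`, which stays OPEN). -/
def Row_A2siP : Prop :=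
  ∀ (C : ℝ) (u : ℝ → E3 → E3), IsTypeIAncientMild C u →
    (∃ K : ℝ, ∃ s δ : ℕ → ℝ, (∀ k, s k < 0) ∧ Tendsto s atTop atBot ∧ Tendsto δ atTop (𝓝 0) ∧
        ∀ k (x : E3), K * Real.sqrt (-s k) ≤ ‖x‖ → Real.sqrt (-s k) * ‖u (s k) x‖ ≤ δ k) →
    ∀ t < 0, ∀ x, u t x = 0

/-- **Row A2si-U** (below the universal floor along a sequence, EXCLUDED — PROVED): for every `C` and every similarity
ball there is a level `f(C, η₀, ρ) > 0` such that `f`-quietness on `√(−s_k)·B̄(η₀, ρ)` along some `s_k → −∞` forces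
`u ≡ 0`.  Generalises the tree's `substantial_at_large_scales` (the ball `B̄(0, K_C)`) to every similarity ball. -/
def Row_A2siU : Prop :=
  ∀ (C : ℝ) (η₀ : E3) (ρ : ℝ), 0 < ρ → ∃ f > (0 : ℝ), ∀ u : ℝ → E3 → E3, IsTypeIAncientMild C u →
    (∃ s : ℕ → ℝ, (∀ k, s k < 0) ∧ Tendsto s atTop atBot ∧
        ∀ k (x : E3), ‖x - Real.sqrt (-s k) • η₀‖ ≤ ρ * Real.sqrt (-s k) → Real.sqrt (-s k) * ‖u (s k) x‖ ≤ f) →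
    ∀ t < 0, ∀ x, u t x = 0

/-- **Row A2si-N** (a NODAL backward parabola — aperture ZERO; OPEN typed residual): `u(s, √(−s)η₀) = 0` for all
`s` before some `T` ⇒ `u ≡ 0`.  NOT decided here: the floor law needs a ball of positive similarity radius.  The cell
contains every point-symmetric element (`u(t, −x) = −u(t, x)` forces `u(t, 0) = 0`, `control_odd_nodal`), so the row
is at least the point-symmetric case of (L′). -/
@[conjecture] def Row_A2siN : Prop :=
  ∀ (C : ℝ) (u : ℝ → E3 → E3), IsTypeIAncientMild C u →
    (∃ (η₀ : E3) (T : ℝ), T < 0 ∧ ∀ s < T, u s (Real.sqrt (-s) • η₀) = 0) →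
    ∀ t < 0, ∀ x, u t x = 0

/-! ### Row proofs -/

/-- **Row A2si0 holds.** -/
theorem row_A2si0 : Row_A2si0 := by
  intro C u hu ⟨η₀, ρ, hρ, s, δ, hs0, hslim, hδ, hq⟩
  refine eq_zero_of_silentAlong hu (η₀ := η₀) (s := s) hρ ⟨hs0, hslim, δ, hδ, fun k x hx => ?_⟩
  rw [simBall, Metric.mem_closedBall, dist_eq_norm] at hx
  exact hq k x hx

/-- **Row A2siE holds.** -/
theorem row_A2siE : Row_A2siE := by
  intro C u hu ⟨K, hK, s, δ, hs0, hslim, hδ, hq⟩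
  refine row_A2si0 C u hu ⟨0, K, hK, s, δ, hs0, hslim, hδ, fun k x hx => hq k x ?_⟩
  simpa using hx

/-- A unit vector of `ℝ³`. -/
def e₀ : E3 := EuclideanSpace.single 0 1

/-- `‖e₀‖ = 1`. -/
theorem norm_e₀ : ‖e₀‖ = 1 := by simp [e₀]

/-- **Row A2siP holds.** -/
theorem row_A2siP : Row_A2siP := by
  intro C u hu ⟨K, s, δ, hs0, hslim, hδ, hq⟩
  -- the similarity ball `B̄((|K|+1)e₀, 1)` lies outside the paraboloid of aperture `K`
  refine row_A2si0 C u hu ⟨(|K| + 1) • e₀, 1, one_pos, s, δ, hs0, hslim, hδ, fun k x hx => hq k x ?_⟩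
  have hr : 0 ≤ Real.sqrt (-s k) := Real.sqrt_nonneg _
  have hc : ‖Real.sqrt (-s k) • ((|K| + 1) • e₀)‖ = (|K| + 1) * Real.sqrt (-s k) := by
    rw [norm_smul, norm_smul, norm_e₀, Real.norm_eq_abs, Real.norm_eq_abs, abs_of_nonneg hr,
      abs_of_nonneg (by positivity)]
    ring
  have h1 : (|K| + 1) * Real.sqrt (-s k) - 1 * Real.sqrt (-s k) ≤ ‖x‖ := by
    have := norm_sub_norm_le (Real.sqrt (-s k) • ((|K| + 1) • e₀)) x
    rw [hc, norm_sub_rev] at this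
    linarith
  calc K * Real.sqrt (-s k) ≤ |K| * Real.sqrt (-s k) := mul_le_mul_of_nonneg_right (le_abs_self K) hr
    _ = (|K| + 1) * Real.sqrt (-s k) - 1 * Real.sqrt (-s k) := by ring
    _ ≤ ‖x‖ := h1

/-- **Row A2siU holds.** -/
theorem row_A2siU : Row_A2siU := by
  intro C η₀ ρ hρ
  obtain ⟨f, hf, hfl⟩ := universal_floor C η₀ hρ
  refine ⟨f, hf, fun u hu ⟨s, hs0, hslim, hq⟩ => ?_⟩
  by_contra hne
  push Not at hne
  obtain ⟨k, x, hx, hlt⟩ := hfl u hu hne s hs0 hslim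
  rw [simBall, Metric.mem_closedBall, dist_eq_norm] at hx
  exact absurd (hq k x hx) (not_le.2 hlt)

/-! ### Nestings (the residual is none of the decided rows renamed) -/

/-- The universal row implies the element-level row (a level tending to `0` is eventually below `f`). -/
theorem row_A2si0_of_row_A2siU (h : Row_A2siU) : Row_A2si0 := by
  intro C u hu ⟨η₀, ρ, hρ, s, δ, hs0, hslim, hδ, hq⟩
  obtain ⟨f, hf, hrow⟩ := h C η₀ ρ hρ
  -- from some index on, `δ k ≤ f`; shift the sequence
  obtain ⟨N, hN⟩ := (hδ.eventually (eventually_le_nhds hf)).exists_forall_of_atTop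
  refine hrow u hu ⟨fun k => s (k + N), fun k => hs0 _, ?_, fun k x hx => (hq (k + N) x hx).trans (hN _ ?_)⟩
  · exact hslim.comp (tendsto_add_atTop_nat N)
  · exact Nat.le_add_left N k

/-- Nesting: A2si0 implies A2siE. -/
theorem row_A2siE_of_row_A2si0 (h : Row_A2si0) : Row_A2siE := by
  intro C u hu ⟨K, hK, s, δ, hs0, hslim, hδ, hq⟩
  refine h C u hu ⟨0, K, hK, s, δ, hs0, hslim, hδ, fun k x hx => hq k x ?_⟩
  simpa using hx

/-! ### Placement of g16-2's residual `Row_A2arP` (honesty addendum, PROVED nesting) -/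

/-- g16-2 «loudness-meter»'s OPEN row, restated VERBATIM: `ε`-quiet (`ε < 1`) outside a paraboloid on a far-past
end ⇒ `u ≡ 0`. -/
@[conjecture] def Row_A2arP : Prop :=
  ∀ (C : ℝ) (u : ℝ → E3 → E3), IsTypeIAncientMild C u →
    (∃ ε : ℝ, ε < 1 ∧ ∃ K T : ℝ, T < 0 ∧ ∀ s : ℝ, s < T → ∀ x : E3, K * Real.sqrt (-s) ≤ ‖x‖ →
        Real.sqrt (-s) * ‖u s x‖ ≤ ε) →
    ∀ t < 0, ∀ x, u t x = 0

/-- The TYPE-I-ENVELOPE LIOUVILLE statement for the class (OPEN; the far-past / self-similar-variables heart of the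
Koch–Nadirashvili–Seregin–Šverák programme as typed in the tree's `HasTypeIDecay`): a class element under a
space–time Type-I envelope `‖u(t, x)‖ ≤ C₀/(‖x‖ + √(−t))` vanishes. -/
@[conjecture] def EnvelopeLiouville : Prop :=
  ∀ (C₀ C : ℝ) (u : ℝ → E3 → E3), IsTypeIAncientMild C u → HasTypeIDecay C₀ u → ∀ t < 0, ∀ x, u t x = 0

/-- Envelope elements are `C₀/(K+1)`-quiet outside the paraboloid of aperture `K`. -/
theorem envelope_quiet_outside {C₀ : ℝ} (hC₀ : 0 ≤ C₀) (hd : HasTypeIDecay C₀ u) {K : ℝ} (hK : 0 ≤ K) {s : ℝ}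
    (hs : s < 0) {x : E3} (hx : K * Real.sqrt (-s) ≤ ‖x‖) : Real.sqrt (-s) * ‖u s x‖ ≤ C₀ / (K + 1) := by
  have hr : 0 < Real.sqrt (-s) := Real.sqrt_pos.2 (by linarith)
  have h1 := hd s hs x
  have hden : (K + 1) * Real.sqrt (-s) ≤ ‖x‖ + Real.sqrt (-s) := by linarith
  have hden0 : 0 < (K + 1) * Real.sqrt (-s) := by positivity
  calc Real.sqrt (-s) * ‖u s x‖ ≤ Real.sqrt (-s) * (C₀ / (‖x‖ + Real.sqrt (-s))) :=
        mul_le_mul_of_nonneg_left h1 hr.le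
    _ ≤ Real.sqrt (-s) * (C₀ / ((K + 1) * Real.sqrt (-s))) :=
        mul_le_mul_of_nonneg_left (div_le_div_of_nonneg_left hC₀ hden0 hden) hr.le
    _ = C₀ / (K + 1) := by field_simp

/-- **`Row_A2arP` is at least envelope-hard** (PROVED nesting): the paraboloidal row implies the Type-I-envelope
Liouville statement (`ε = C₀/(2C₀+2) ≤ 1/2`, aperture `K = 2C₀ + 1`). -/
theorem envelopeLiouville_of_row_A2arP (h : Row_A2arP) : EnvelopeLiouville := by
  intro C₀ C u hu hd
  by_cases hC₀ : 0 ≤ C₀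
  · refine h C u hu ⟨C₀ / (2 * C₀ + 1 + 1), ?_, 2 * C₀ + 1, -1, by norm_num, fun s hs x hx => ?_⟩
    · rw [div_lt_one (by positivity)]; linarith
    · exact envelope_quiet_outside hC₀ hd (by positivity) (by linarith) hx
  · -- a negative envelope constant is absurd
    exfalso
    push Not at hC₀
    have h1 := hd (-1) (by norm_num) 0
    have h2 : C₀ / (‖(0 : E3)‖ + Real.sqrt (-(-1 : ℝ))) < 0 := by
      rw [norm_zero, zero_add, neg_neg, Real.sqrt_one, div_one]; exact hC₀
    linarith [norm_nonneg (u (-1) 0)]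

/-- The aperture in `Row_A2siP` must be FIXED: if the aperture may grow as the level drops (`K = C₀/ε`), every
Type-I-ENVELOPE element meets the hypothesis at every level, so that version of the row contains `EnvelopeLiouville`
(OPEN) — the honest boundary of the decided cell. -/
theorem control_envelope_tail {C₀ : ℝ} (hC₀ : 0 ≤ C₀) (hd : HasTypeIDecay C₀ u) {ε : ℝ} (hε : 0 < ε) :
    ∃ K : ℝ, 0 ≤ K ∧ ∀ s < 0, ∀ x : E3, K * Real.sqrt (-s) ≤ ‖x‖ → EpochMeter.amp u s x ≤ ε := by
  refine ⟨C₀ / ε, by positivity, fun s hs x hx => ?_⟩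
  have h := envelope_quiet_outside hC₀ hd (by positivity) hs hx
  have hε' : ε ≠ 0 := hε.ne'
  have h1 : ε * (C₀ / ε) = C₀ := by field_simp
  have h2 : ε * (C₀ / ε + 1) = C₀ + ε := by rw [mul_add, h1, mul_one]
  have h3 : C₀ / (C₀ / ε + 1) ≤ ε := by
    rw [div_le_iff₀ (by positivity)]
    linarith
  exact h.trans h3

/-- `Row_A2siE` sharpens g16-3's calibration corner `Row_A2epC` (quiet core slices at EVERY level AND EVERY aperture ⇒ 0,
the contrapositive of `substantial_at_large_scales`): here ONE arbitrarily thin aperture suffices.  Formally the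
all-apertures hypothesis yields the thin-core silent sequence. -/
theorem row_A2epC_of_row_A2siE (h : Row_A2siE) :
    ∀ (C : ℝ) (u : ℝ → E3 → E3), IsTypeIAncientMild C u →
      (∀ ε > (0 : ℝ), ∀ K > (0 : ℝ), ∀ T < (0 : ℝ), ∃ s < T,
        ∀ x : E3, ‖x‖ ≤ K * Real.sqrt (-s) → Real.sqrt (-s) * ‖u s x‖ ≤ ε) →
      ∀ t < 0, ∀ x, u t x = 0 := by
  intro C u hu hyp
  have h' : ∀ k : ℕ, ∃ s < -((k : ℝ) + 1), ∀ x : E3, ‖x‖ ≤ 1 * Real.sqrt (-s) →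
      Real.sqrt (-s) * ‖u s x‖ ≤ 1 / ((k : ℝ) + 1) :=
    fun k => hyp _ (by positivity) 1 one_pos _ (by linarith [(Nat.cast_nonneg k : (0 : ℝ) ≤ k)])
  choose s hs hq using h'
  have hlin : Tendsto (fun k : ℕ => -((k : ℝ) + 1)) atTop atBot :=
    tendsto_neg_atTop_atBot.comp (tendsto_atTop_add_const_right atTop (1 : ℝ) tendsto_natCast_atTop_atTop)
  exact h C u hu ⟨1, one_pos, s, fun k => 1 / ((k : ℝ) + 1),
    fun k => by linarith [hs k, (Nat.cast_nonneg k : (0 : ℝ) ≤ k)],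
    tendsto_atBot_mono (fun k => (hs k).le) hlin, tendsto_one_div_add_atTop_nhds_zero_nat, fun k x hx => hq k x hx⟩

/-! ### The rung decides every row -/

/-- (L′) decides every row (informational). -/
theorem rows_of_L' (hL : ∀ (C : ℝ) (u : ℝ → E3 → E3), IsTypeIAncientMild C u → ∀ t < 0, ∀ x, u t x = 0) :
    Row_A2si0 ∧ Row_A2siE ∧ Row_A2siP ∧ Row_A2siU ∧ Row_A2siN ∧ Row_A2arP ∧ EnvelopeLiouville :=
  ⟨fun C u hu _ => hL C u hu, fun C u hu _ => hL C u hu, fun C u hu _ => hL C u hu,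
    fun C _ _ _ => ⟨1, one_pos, fun u hu _ => hL C u hu⟩, fun C u hu _ => hL C u hu,
    fun C u hu _ => hL C u hu, fun _ C u hu _ => hL C u hu⟩

/-- (L′) BY NAME decides every row of this line. -/
theorem rows_of_rung (hL : Theses.SymmetryModuliCount.TypeIAncientLiouville) :
    Row_A2si0 ∧ Row_A2siE ∧ Row_A2siP ∧ Row_A2siU ∧ Row_A2siN ∧ Row_A2arP ∧ EnvelopeLiouville :=
  rows_of_L' fun C u hu => hL C u ((isTypeIAncientMild_iff).1 hu)

/-! ## G. Controls (the readings are honest; the class carries the exclusions) -/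

/-- The zero field is silent on every ball along every sequence: silence alone is consistent — the CLASS +
`substantial_at_large_scales` carry the exclusion. -/
theorem control_zero_silent (η₀ : E3) (ρ : ℝ) {s : ℕ → ℝ} (hs0 : ∀ k, s k < 0) (hslim : Tendsto s atTop atBot) :
    SilentAlong (fun _ _ => (0 : E3)) η₀ ρ s :=
  ⟨hs0, hslim, fun _ => 0, tendsto_const_nhds, fun k x hx => by simp [EpochMeter.amp]⟩

/-- The zero field has NO positive floor anywhere (so `hasFloor_of_ne_zero` genuinely uses `u ≠ 0`). -/
theorem control_zero_noFloor (η₀ : E3) (ρ : ℝ) {f : ℝ} (hf : 0 ≤ f) : ¬ HasFloor (fun _ _ => (0 : E3)) η₀ ρ f := by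
  rintro ⟨T, hT, h⟩
  obtain ⟨x, hx, hlt⟩ := h (T - 1) (by linarith)
  simp [EpochMeter.amp] at hlt
  linarith

/-- Point-symmetric (odd) fields are nodal on the axis parabola `η₀ = 0`: the hypothesis of the OPEN `Row_A2siN` is met
by every odd field, so `Row_A2siN` contains the point-symmetric case of (L′). -/
theorem control_odd_nodal (hodd : ∀ t (x : E3), u t (-x) = -u t x) (s : ℝ) :
    u s (Real.sqrt (-s) • (0 : E3)) = 0 := by
  have h := hodd s 0
  rw [neg_zero] at h
  have h2 : (2 : ℝ) • u s 0 = 0 := by rw [two_smul]; nth_rewrite 1 [h]; simp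
  simpa using h2

/-- Readings are capped by `C` on the class, so every floor satisfies `f < C`: the universal level `f(C, B)` of
`universal_floor` is a genuine sub-`C` quantity (and must tend to `0` as the ball recedes, since far-field readings of
an envelope-type element are small — not proved here, no such element is known). -/
theorem floor_lt_of_hasFloor (hu : IsTypeIAncientMild C u) {η₀ : E3} {ρ f : ℝ} (h : HasFloor u η₀ ρ f) : f < C := by
  obtain ⟨T, hT, hfl⟩ := h
  obtain ⟨x, hx, hlt⟩ := hfl (T - 1) (by linarith)
  exact hlt.trans_le (EpochMeter.amp_le hu (by linarith) x)

end Summit.NavierStokesRegularity.NavierStokesRegularity.Theorems.ScenarioCensus.SilenceMeter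

end
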